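import Literature.MathematicalPhysics.QuantumFieldTheory.Balaban1983to89.B9RWSums346SecondDiffGpLeft

/-!
# `Balaban1983to89.B9RWSums346SecondDiffLeft` — [B9] the same-side second-order `L²` members (3.46)₃,₅ of Theorem 3.10's sum `G(U)` (3.107) BY THE LEFT NEUMANN SERIES
# `G∇\*∇\* = Σₙ (Σ_a R♯_a)ⁿ(G₀∇\*∇\*)` — NO THIRD-ORDER FACTOR: the `310` twin of `B9RWSums346SecondDiffGpLeft` (dag-n06-k's `B9RWSums346SecondDiff.l2line5_of_local310` with
# the displayed schema `FactorsL2Second310.facDD` (the terms `R_a∇\*∇\*`, order three) REPLACED by the transposed factors `R♯_a` of `Factors389.facT` (first order))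

T. Bałaban, *Propagators for lattice gauge theories in a background field*, Commun. Math. Phys. **99** (1985) 389–434 [`Balaban1985BackgroundPropagators`, "B9"],
Thm 3.10 (3.105)–(3.108) pp. 414–416, (3.87)–(3.90) pp. 408–410, (3.46) p. 398, p. 391, p. 413; T. Bałaban, *Propagators and renormalization transformations for lattice
gauge theories. II*, Commun. Math. Phys. **96** (1984) 223–250 [`Balaban1984PropagatorsII`, "[4]"], (2.52)–(2.55) pp. 232–233, Lemma 2.1 (2.60)–(2.61) p. 234;
T. Bałaban, *The variational problem and background fields …*, Commun. Math. Phys. **102** (1985) 277–309 [`Balaban1985Variational`], (188) p. 308.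

statement-level skeleton of published theorems with citation tags; proofs where landed; nothing here is a claim about the Yang–Mills mass gap

THE PRINT.  p. 416: *«From (3.108) it follows that the expansion (3.107) is convergent in all norms in the inequalities (3.42)–(3.47)»*; (3.105)–(3.106) p. 414:
`Δ_aG₀ = I − R`, `G = G₀(I − R)⁻¹`; transposed (`Identities310.invT ∕ eq3105T`: `Δ_aG = I`, `G₀Δ_a = I − Σ_a R♯_a`): `G = G₀ + (Σ_a R♯_a)·G` (`B9Thm37Glue.fixedPoint_of_388T`),
hence `G∇\*_ν∇\*_μ = G₀∇\*_ν∇\*_μ + (Σ_a R♯_a)·(G∇\*_ν∇\*_μ)` — a LEFT fixed point whose kernel is FIRST order (p. 413: *«R_α(X) … satisfies a bound of the type (3.89), possibly with an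
additional power of Lʲη»* — `Factors389.facT`).
WHY (cell `pub-ymgap`, node N06 [B9], rows 19; width seat `pub-ymgap-dag-n06-w1` (g5)).  The certificate's `h36HA` displays `L2SecondLegs310 (𝔬A x) (𝔡A x) … ∧ FactorsL2Second310 (𝔬A x)
(𝔡A x) …`; the second conjunct is ORDER THREE (the terms `R_a∇\*∇\*`).  THIS FILE proves the same conclusions with it REPLACED by the transposed factors' sup majorants
`Factors389.facT ∕ fac` (ALREADY displayed in `h36A ∋ Factors389`) through the Schur test:
* §1 ★★ `l2line5_left_of_blockBd310` — head legs `L2SecondLegs310` (`B₃, δ₁, N₃`) + `hV : BlockBd blk blk (Σ_a R♯_a) (θ_V·e^{−δ₁d})` + `θ_V·c₁(α₁) ≤ ½` + the two transposed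
  identities `Δ_aG = I`, `G₀Δ_a = I − Σ_a R♯_a` (fields `invT ∕ eq3105T` of `Identities310` or `Identities310₂`, passed as equations) ⊢ `BlockBd blk blk (G ∘ (∇\*_ν ∘ ∇\*_μ))
  (2N₃B₃·e^{−(1−α₁)δ₁d})` (`B11SectG.neumann_majorant`, a-priori bound `B9RWSums346SecondDiffGpLeft.exists_blockBd_const`); ★ `l2line3_left_of_blockBd310` (adjoint transfer);
* §2 `isTransposePair_sumRt_sumRf`, ★★ `blockBd_sumRt_of_factors389` — `hV` DISCHARGED from `Factors389` (both majorants), the factor transposes `R♯_a = R_aᵀ`, the overlap `N_F`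
  (`StaticOK310.cntF`) and p. 398's scale transfer: `BlockBd blk blk (Σ_a R♯_a) (N_Fθ₀M⁻¹√L₀·e^{−(δ₀−αδ)d})` — print's `O(M⁻¹)`;
* §3 ★★★ `l2line5_left_of_factors389`, ★★★ `blockBd_second_family5_left_of_factors389` ∕ `blockBd_second_family3_left_of_factors389` — the drop-in forms (hypotheses of
  `l2line5_of_local310` WITHOUT `FactorsL2Second310` and WITHOUT the sup majorant `h0` of `G`, plus `Factors389`, the factor transposes and `N_Fθ₀M⁻¹√L₀·c₁(α₁) ≤ ½`).
HONEST SCOPE.  Majorant bookkeeping over landed `L²` calculus; the legs, the factor majorants, (3.105)–(3.106) and the smallness are HYPOTHESES (schemas ∕ displayed inequalities);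
nothing of [B9] asserted; nobody's statement is modified; COUNT-NEUTRAL; N06 NOT discharged; K1 NOT closed; one finite lattice programme — nothing continuum, nothing about OS
positivity or the mass gap; the YM mass gap (Clay) is NOT proved by any of this — R4 closes the conditional finite-𝕋⁴ rung `BalabanLadder.UV` only.  NEW file; 0 `def`.
-/

namespace Literature.MathematicalPhysics.QuantumFieldTheory.Balaban1983to89.B9RWSums346SecondDiffLeft

open Literature.MathematicalPhysics.QuantumFieldTheory.Balaban1983to89
open Finset B6RandomWalk B6RandomWalkHom B9Thm37Sum B9Thm34Ext B9Thm37Glue B9Thm37Whole B9Cor38Whole B9Thm310Whole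
open B9RWSums343to347Whole B9RWSums346Schur B9Thm37GlueCor36 B9RWSums343Holder B9RWSums346Lap
open B9RWSums344Input B9RWSums346Two B11SectG B9Thm37AllNorms B9SectDL2Decay B9RWSums346SecondDiff B9RWSums346SecondDiffGpLeft

noncomputable section

section GSide

variable {g : B9.Geometry} [Fintype g.Site] [DecidableEq g.Site] {R : ℝ} {H : Prop} {B : B9.Backgrounds}
variable {X Y ι A P : Type}

omit [Fintype g.Site] [DecidableEq g.Site] in
/-- Algebra of the transposed (3.106) read through an operator on the right: `G = G₀ + V·G` gives `G∘E = G₀∘E + V∘(G∘E)`. [folklore] -/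
private theorem left_split {Y' : Type} {E : (Y' → ℝ) →ₗ[ℝ] (X → ℝ)} {G G0 V : Module.End ℝ (X → ℝ)} (h : G = G0 + V * G) :
    G ∘ₗ E = G0 ∘ₗ E + V ∘ₗ (G ∘ₗ E) := by
  conv_lhs => rw [h]
  apply LinearMap.ext
  intro μ
  simp only [LinearMap.comp_apply, LinearMap.add_apply, Module.End.mul_apply]

/-! ## §1 The sixth and fourth `L²` members of (3.46) for `G` by the LEFT Neumann series -/

/-- ★★ **THE SIXTH `L²` MEMBER OF (3.46) FOR THEOREM 3.10's SUM `G(U)`, PER DIRECTION PAIR, BY THE LEFT NEUMANN SERIES** — no third-order factor: from the head legs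
`h_□G_□h_□∇\*_ν∇\*_μ` (schema `L2SecondLegs310`, overlap `N₃`), an `L²` block bound `θ_V·e^{−δ₁d}` of `Σ_a R♯_a(U)` with `θ_V·c₁(α₁) ≤ ½`, the transposed identities
`Δ_aG = I`, `G₀Δ_a = I − Σ_a R♯_a` ((3.105)–(3.106) transposed), and [4] Lemma 2.1 (2.61) at `(δ₁, α₁)`: `‖1_{Δ(y)}G∇\*_ν∇\*_μλ‖₂ ≤ 2N₃B₃·e^{−(1−α₁)δ₁d(y,y′)}‖λ‖₂`, `supp λ ⊂ Δ(y′)`.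
[cite: Balaban1985BackgroundPropagators, Thm 3.10 (3.105)–(3.108) pp.414–416 + (3.46) p.398 + p.391; Balaban1984PropagatorsII, (2.52)–(2.55) pp.232–233 + Lemma 2.1 (2.61) p.234; Balaban1985Variational, (188) p.308] -/
theorem l2line5_left_of_blockBd310 [Fintype X] [DecidableEq X] [Fintype ι] [Fintype A]
    (𝔬 : Ops310 g B X Y ι A) (𝔡 : DirOps310 𝔬 P) (R : ℝ) (H : Prop) (d₁ : ℕ) (δ₁ α₁ ρ N N' NF Cℓ N3 B3 θV : ℝ) (κ : Sizes310)
    (S3 : ι → Finset g.Site) (U : B.Cfg)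
    (hN3 : 0 ≤ N3) (hB3 : 0 ≤ B3) (hθV : 0 ≤ θV) (hα₁δ₁ : 0 ≤ α₁ * δ₁) (hα₁δ₁' : α₁ * δ₁ ≤ δ₁)
    (hs : StaticOK310 𝔬 ρ N N' NF Cℓ κ) (hcnt3 : ∀ a : g.Site, (∑ i, if a ∈ S3 i then (1 : ℝ) else 0) ≤ N3)
    (h261 : Ineq261 d₁ (toB6 g R H) δ₁ α₁) (hinvT : 𝔬.Δa U * 𝔬.G U = 1)
    (h105T : (∑ i, mulOp (𝔬.h i) * 𝔬.Gsq U i * mulOp (𝔬.h i)) * 𝔬.Δa U = 1 - ∑ a, 𝔬.Rt U a)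
    (hL : L2SecondLegs310 𝔬 𝔡 R H S3 B3 δ₁ U)
    (hV : BlockBd (g := toB6 g R H) 𝔬.blk 𝔬.blk (∑ a, 𝔬.Rt U a) (fun (y y' : g.Site) => θV * Real.exp (-(δ₁ * g.dist y y'))))
    (hsmall : θV * B6.c1 d₁ δ₁ α₁ ≤ 1 / 2) (ν μ : P) :
    BlockBd (g := toB6 g R H) 𝔬.blk 𝔬.blk (𝔬.G U ∘ₗ (𝔡.Dsd U ν ∘ₗ 𝔡.Dsd U μ))
      (fun (y y' : g.Site) => 2 * (N3 * B3) * Real.exp (-((1 - α₁) * δ₁ * g.dist y y'))) := by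
  have htri : Triangle254 (toB6 g R H) := fun a b c => hs.tri a b c
  have hdnn : ∀ a b : (toB6 g R H).Site, 0 ≤ (toB6 g R H).dist a b := fun a b => hs.dnn a b
  have hrow : RowSum (toB6 g R H) (α₁ * δ₁) (B6.c1 d₁ δ₁ α₁) := (rowSum_iff_ineq261 d₁ (toB6 g R H) δ₁ α₁).mp h261
  have hρ0 : 0 ≤ (1 - α₁) * δ₁ := by nlinarith
  -- the transposed (3.106), read through `∇*_ν∇*_μ`
  have hfix := left_split (E := 𝔡.Dsd U ν ∘ₗ 𝔡.Dsd U μ) (fixedPoint_of_388T hinvT h105T)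
  have hsumE : (∑ i, mulOp (𝔬.h i) * 𝔬.Gsq U i * mulOp (𝔬.h i)) ∘ₗ (𝔡.Dsd U ν ∘ₗ 𝔡.Dsd U μ) =
      ∑ i, (mulOp (𝔬.h i) * 𝔬.Gsq U i * mulOp (𝔬.h i)) ∘ₗ (𝔡.Dsd U ν ∘ₗ 𝔡.Dsd U μ) := by
    apply LinearMap.ext
    intro f
    simp only [LinearMap.comp_apply, LinearMap.sum_apply]
  have hhead := blockBd_localSum (R := R) (H := H) 𝔬.blk 𝔬.blk
    (fun i => (mulOp (𝔬.h i) * 𝔬.Gsq U i * mulOp (𝔬.h i)) ∘ₗ (𝔡.Dsd U ν ∘ₗ 𝔡.Dsd U μ))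
    (fun i (a : g.Site) => if a ∈ S3 i then (1 : ℝ) else 0) (fun (a b : g.Site) => B3 * Real.exp (-(δ₁ * g.dist a b))) N3
    (fun a b => mul_nonneg hB3 (Real.exp_nonneg _)) (fun i => hL.l5 i ν μ) hcnt3
  rw [← hsumE] at hhead
  have hS : BlockBd (g := toB6 g R H) 𝔬.blk 𝔬.blk ((∑ i, mulOp (𝔬.h i) * 𝔬.Gsq U i * mulOp (𝔬.h i)) ∘ₗ (𝔡.Dsd U ν ∘ₗ 𝔡.Dsd U μ))
      (fun (a b : g.Site) => N3 * B3 * Real.exp (-((1 - α₁) * δ₁ * (toB6 g R H).dist a b))) := by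
    refine hhead.mono fun a b => ?_
    have hexp : Real.exp (-(δ₁ * g.dist a b)) ≤ Real.exp (-((1 - α₁) * δ₁ * g.dist a b)) :=
      Real.exp_le_exp.mpr (neg_le_neg (mul_le_mul_of_nonneg_right (by nlinarith) (hs.dnn a b)))
    calc N3 * (B3 * Real.exp (-(δ₁ * g.dist a b))) = N3 * B3 * Real.exp (-(δ₁ * g.dist a b)) := by ring
      _ ≤ N3 * B3 * Real.exp (-((1 - α₁) * δ₁ * g.dist a b)) := mul_le_mul_of_nonneg_left hexp (mul_nonneg hN3 hB3)
      _ = N3 * B3 * Real.exp (-((1 - α₁) * δ₁ * (toB6 g R H).dist a b)) := by simp only [toB6_dist]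
  have hV' : BlockBd (g := toB6 g R H) 𝔬.blk 𝔬.blk (∑ a, 𝔬.Rt U a) (fun (a b : g.Site) => θV * Real.exp (-(δ₁ * (toB6 g R H).dist a b))) :=
    hV.mono fun a b => by simp only [toB6_dist]; exact le_rfl
  obtain ⟨M₀, hM₀, hap⟩ := exists_blockBd_const (g := g) (R := R) (H := H) 𝔬.blk 𝔬.blk (𝔬.G U ∘ₗ (𝔡.Dsd U ν ∘ₗ 𝔡.Dsd U μ))
  rw [blockBd_iff_hasMaj] at hS hV' hap
  have hq : (l2w (toB6 g R H) 𝔬.blk (fun _ => (1 : ℝ)) (fun _ => zero_le_one)).κ * θV * B6.c1 d₁ δ₁ α₁ < 1 := by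
    rw [l2w_κ, one_mul]; linarith
  have hN := neumann_majorant (b₁ := l2w (toB6 g R H) 𝔬.blk (fun _ => (1 : ℝ)) (fun _ => zero_le_one))
    (b₂ := l2w (toB6 g R H) 𝔬.blk (fun _ => (1 : ℝ)) (fun _ => zero_le_one)) htri hdnn hrow hθV (mul_nonneg hN3 hB3) hM₀ hρ0 (by linarith)
    hV' hS hfix hap hq
  rw [blockBd_iff_hasMaj]
  refine hN.mono fun a b => ?_
  rw [l2w_κ, one_mul]
  have hinv : (1 - θV * B6.c1 d₁ δ₁ α₁)⁻¹ ≤ 2 := by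
    rw [inv_le_comm₀ (by linarith) (by norm_num : (0 : ℝ) < 2)]
    linarith
  have hK0 : 0 ≤ N3 * B3 := mul_nonneg hN3 hB3
  calc N3 * B3 * (1 - θV * B6.c1 d₁ δ₁ α₁)⁻¹ * Real.exp (-((1 - α₁) * δ₁ * (toB6 g R H).dist a b))
      ≤ N3 * B3 * 2 * Real.exp (-((1 - α₁) * δ₁ * (toB6 g R H).dist a b)) :=
        mul_le_mul_of_nonneg_right (mul_le_mul_of_nonneg_left hinv hK0) (Real.exp_nonneg _)
    _ = 2 * (N3 * B3) * Real.exp (-((1 - α₁) * δ₁ * g.dist a b)) := by simp only [toB6_dist]; ring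

/-- ★ **THE FOURTH `L²` MEMBER OF (3.46) FOR `G(U)`, PER DIRECTION PAIR, BY ADJOINT TRANSFER** — `∇_ν∇_μG = (G∇\*_μ∇\*_ν)ᵀ` (`G` symmetric, `∇\*_κ = ∇_κᵀ`).
[cite: Balaban1985BackgroundPropagators, (3.46) p.398 (fourth member) + p.398 ll.28–31 + p.391 + Thm 3.11 p.416] -/
theorem l2line3_left_of_blockBd310 [Fintype X] [DecidableEq X] [Fintype ι] [Fintype A]
    (𝔬 : Ops310 g B X Y ι A) (𝔡 : DirOps310 𝔬 P) (R : ℝ) (H : Prop) (d₁ : ℕ) (δ₁ α₁ ρ N N' NF Cℓ N3 B3 θV : ℝ) (κ : Sizes310)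
    (S3 : ι → Finset g.Site) (U : B.Cfg)
    (hN3 : 0 ≤ N3) (hB3 : 0 ≤ B3) (hθV : 0 ≤ θV) (hα₁δ₁ : 0 ≤ α₁ * δ₁) (hα₁δ₁' : α₁ * δ₁ ≤ δ₁)
    (hs : StaticOK310 𝔬 ρ N N' NF Cℓ κ) (hcnt3 : ∀ a : g.Site, (∑ i, if a ∈ S3 i then (1 : ℝ) else 0) ≤ N3)
    (h261 : Ineq261 d₁ (toB6 g R H) δ₁ α₁) (hinvT : 𝔬.Δa U * 𝔬.G U = 1)
    (h105T : (∑ i, mulOp (𝔬.h i) * 𝔬.Gsq U i * mulOp (𝔬.h i)) * 𝔬.Δa U = 1 - ∑ a, 𝔬.Rt U a)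
    (hL : L2SecondLegs310 𝔬 𝔡 R H S3 B3 δ₁ U)
    (hV : BlockBd (g := toB6 g R H) 𝔬.blk 𝔬.blk (∑ a, 𝔬.Rt U a) (fun (y y' : g.Site) => θV * Real.exp (-(δ₁ * g.dist y y'))))
    (hsmall : θV * B6.c1 d₁ δ₁ α₁ ≤ 1 / 2) (hDT : DirTranspose310 𝔬 𝔡 U) (hsym : IsTransposePair (𝔬.G U) (𝔬.G U)) (ν μ : P) :
    BlockBd (g := toB6 g R H) 𝔬.blk 𝔬.blk ((𝔡.Dd U ν ∘ₗ 𝔡.Dd U μ) ∘ₗ 𝔬.G U)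
      (fun (y y' : g.Site) => 2 * (N3 * B3) * Real.exp (-((1 - α₁) * δ₁ * g.dist y y'))) := by
  have h5 := l2line5_left_of_blockBd310 𝔬 𝔡 R H d₁ δ₁ α₁ ρ N N' NF Cℓ N3 B3 θV κ S3 U hN3 hB3 hθV hα₁δ₁ hα₁δ₁' hs hcnt3 h261 hinvT h105T hL hV
    hsmall μ ν
  have hK : 0 ≤ 2 * (N3 * B3) := by positivity
  have hadj : IsTransposePair (𝔬.G U ∘ₗ (𝔡.Dsd U μ ∘ₗ 𝔡.Dsd U ν)) ((𝔡.Dd U ν ∘ₗ 𝔡.Dd U μ) ∘ₗ 𝔬.G U) :=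
    ((hDT.tr ν).comp (hDT.tr μ)).comp hsym
  have h := blockBd_of_adjoint (g := toB6 g R H) (blk₁ := 𝔬.blk) (blk₂ := 𝔬.blk) (T := (𝔡.Dd U ν ∘ₗ 𝔡.Dd U μ) ∘ₗ 𝔬.G U)
    (T' := 𝔬.G U ∘ₗ (𝔡.Dsd U μ ∘ₗ 𝔡.Dsd U ν)) (fun u w => by
      rw [dotProduct, dotProduct]
      exact (hadj u w).symm) h5 (fun y y' => mul_nonneg hK (Real.exp_nonneg _))
  refine h.mono fun y y' => ?_
  rw [hs.symm y' y]

/-! ## §2 The block bound of `Σ_a R♯_a` from the factor majorants (Schur) -/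

omit [Fintype g.Site] [DecidableEq g.Site] in
/-- `Σ_a R♯_a` and `Σ_a R_a` are a transpose pair when each `R♯_a = R_aᵀ` (p. 391; (3.106) and its transpose). [cite: Balaban1985BackgroundPropagators, (3.105)–(3.106) p.414 + p.391] -/
theorem isTransposePair_sumRt_sumRf [Fintype X] [Fintype A] (𝔬 : Ops310 g B X Y ι A) (U : B.Cfg) (hRT : ∀ a, IsTransposePair (𝔬.Rt U a) (𝔬.Rf U a)) :
    IsTransposePair (∑ a, 𝔬.Rt U a) (∑ a, 𝔬.Rf U a) :=
  IsTransposePair.sum hRT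

/-- ★★ **THE `L²` BLOCK BOUND OF `Σ_a R♯_a(U)` FROM THE FACTOR MAJORANTS** (the hypothesis `hV` of §1, DISCHARGED from `Factors389` — displayed in the certificate's `h36A`):
the sup majorants `1_{X_a}(y′)θ₀M⁻¹·(Lʲη)(L^{j′}η)⁻¹e^{−δ₀d}` of `R♯_a` (`facT`) and `1_{X_a}(y)θ₀M⁻¹e^{−δ₀d}` of `R_a` (`fac`), the overlap `Σ_a 1_{X_a} ≤ N_F` (`StaticOK310.cntF`),
the transposes `R♯_a = R_aᵀ`, the Schur test and p. 398's scale transfer (`(Lʲη∕L^{j′}η)e^{−αδd} ≤ L ≤ L₀`, member facts `Facts347 … δ α L₀`):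
`BlockBd blk blk (Σ_a R♯_a) (N_F·θ₀M⁻¹·√L₀·e^{−(δ₀−αδ)d(y,y′)})` — print's `O(M⁻¹)` (p. 413, (3.89)).
[cite: Balaban1985BackgroundPropagators, p.413 + (3.105) p.414 + (3.89) p.409 + (3.46)∕(3.42) pp.397–398 + p.398 remark after (3.47) + p.391; Balaban1984PropagatorsII, Prop. 2.2 (2.51) p.232, Lemma 2.1 (2.60) p.234] -/
theorem blockBd_sumRt_of_factors389 [Fintype X] [Fintype ι] [Fintype A] (𝔬 : Ops310 g B X Y ι A) (U : B.Cfg)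
    {d : ℕ} {δ α L₀ ρ N N' NF Cℓ θ₀ δ₀ : ℝ} {κ : Sizes310} (hF : Facts347 g R H d δ α L₀) (hαδ : 0 ≤ α * δ) (hθ₀ : 0 ≤ θ₀) (hNF : 0 ≤ NF) (hM : 1 ≤ g.M)
    (hs : StaticOK310 𝔬 ρ N N' NF Cℓ κ) (hfac : Factors389 𝔬 R H θ₀ δ₀ U) (hRT : ∀ a, IsTransposePair (𝔬.Rt U a) (𝔬.Rf U a)) :
    BlockBd (g := toB6 g R H) 𝔬.blk 𝔬.blk (∑ a, 𝔬.Rt U a)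
      (fun (y y' : g.Site) => NF * (θ₀ * g.M⁻¹) * Real.sqrt L₀ * Real.exp (-((δ₀ - α * δ) * g.dist y y'))) := by
  have hlen : ∀ y : g.Site, 0 < g.len y := hs.lenpos
  have hMinv0 : 0 ≤ g.M⁻¹ := inv_nonneg.mpr (zero_le_one.trans hM)
  have hA : 0 ≤ θ₀ * g.M⁻¹ := mul_nonneg hθ₀ hMinv0
  -- the two summed sup majorants: `Σ_a R♯_a` (indicator on the input block) and `Σ_a R_a` (indicator on the output block)
  have hVi : ∀ a, HasMajorantHom (g := toB6 g R H) 𝔬.blk 𝔬.blk (𝔬.Rt U a)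
      (fun (y y' : g.Site) => (if y' ∈ 𝔬.SF a then (1 : ℝ) else 0) * (θ₀ * g.M⁻¹) * (g.len y * (g.len y')⁻¹) * Real.exp (-(δ₀ * g.dist y y'))) :=
    fun a => (hasMajorantHom_iff (g := toB6 g R H) 𝔬.blk _ _).mpr (hfac.facT a)
  have hVm : HasMajorantHom (g := toB6 g R H) 𝔬.blk 𝔬.blk (∑ a, 𝔬.Rt U a)
      (fun (y y' : g.Site) => NF * (θ₀ * g.M⁻¹) * g.len y * (g.len y')⁻¹ * Real.exp (-(δ₀ * g.dist y y'))) := by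
    refine hasMajorantHom_mono (g := toB6 g R H) 𝔬.blk 𝔬.blk (hasMajorantHom_fintypeSum 𝔬.blk 𝔬.blk (fun a => 𝔬.Rt U a) _ hVi) fun (y y' : g.Site) => ?_
    have h3 : 0 ≤ (θ₀ * g.M⁻¹) * (g.len y * (g.len y')⁻¹) * Real.exp (-(δ₀ * g.dist y y')) :=
      mul_nonneg (mul_nonneg hA (mul_nonneg (hlen y).le (inv_nonneg.mpr (hlen y').le))) (Real.exp_nonneg _)
    calc (∑ a, (if y' ∈ 𝔬.SF a then (1 : ℝ) else 0) * (θ₀ * g.M⁻¹) * (g.len y * (g.len y')⁻¹) * Real.exp (-(δ₀ * g.dist y y')))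
        = (∑ a, if y' ∈ 𝔬.SF a then (1 : ℝ) else 0) * ((θ₀ * g.M⁻¹) * (g.len y * (g.len y')⁻¹) * Real.exp (-(δ₀ * g.dist y y'))) := by
          rw [Finset.sum_mul]; exact Finset.sum_congr rfl fun a _ => by ring
      _ ≤ NF * ((θ₀ * g.M⁻¹) * (g.len y * (g.len y')⁻¹) * Real.exp (-(δ₀ * g.dist y y'))) := mul_le_mul_of_nonneg_right (hs.cntF y') h3
      _ = NF * (θ₀ * g.M⁻¹) * g.len y * (g.len y')⁻¹ * Real.exp (-(δ₀ * g.dist y y')) := by ring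
  have hRa : ∀ a, HasMajorant (g := toB6 g R H) 𝔬.blk (𝔬.Rf U a)
      (fun (y y' : g.Site) => (if y ∈ 𝔬.SF a then (1 : ℝ) else 0) * ((θ₀ * g.M⁻¹) * Real.exp (-(δ₀ * g.dist y y')))) :=
    fun a => hasMajorant_mono (g := toB6 g R H) 𝔬.blk (hfac.fac a) fun y y' => le_of_eq (by split_ifs <;> simp)
  have hRloc := hasMajorant_localSum (G := toB6 g R H) 𝔬.blk (fun a => 𝔬.Rf U a) (fun a (y : g.Site) => if y ∈ 𝔬.SF a then (1 : ℝ) else 0)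
    (fun (y y' : g.Site) => (θ₀ * g.M⁻¹) * Real.exp (-(δ₀ * g.dist y y'))) NF (fun y y' => mul_nonneg hA (Real.exp_nonneg _)) hRa hs.cntF
  have hsumR : (∑ a, 𝔬.Rf U a) = ∑ a, (fun a => 𝔬.Rf U a) a := rfl
  have hRm : HasMajorantHom (g := toB6 g R H) 𝔬.blk 𝔬.blk (∑ a, 𝔬.Rf U a)
      (fun (y y' : g.Site) => NF * (θ₀ * g.M⁻¹) * Real.exp (-(δ₀ * g.dist y y'))) :=
    (hasMajorantHom_iff (g := toB6 g R H) 𝔬.blk _ _).mpr (hasMajorant_mono (g := toB6 g R H) 𝔬.blk hRloc fun y y' => le_of_eq (by ring))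
  have hKV : ∀ y y' : g.Site, 0 ≤ NF * (θ₀ * g.M⁻¹) * g.len y * (g.len y')⁻¹ * Real.exp (-(δ₀ * g.dist y y')) :=
    fun y y' => mul_nonneg (mul_nonneg (mul_nonneg (mul_nonneg hNF hA) (hlen y).le) (inv_nonneg.2 (hlen y').le)) (Real.exp_nonneg _)
  have hKR : ∀ y y' : g.Site, 0 ≤ NF * (θ₀ * g.M⁻¹) * Real.exp (-(δ₀ * g.dist y y')) := fun y y' => mul_nonneg (mul_nonneg hNF hA) (Real.exp_nonneg _)
  have hS := blockBd_schur (G := toB6 g R H) 𝔬.blk 𝔬.blk hKV hKR hVm hRm (isTransposePair_sumRt_sumRf 𝔬 U hRT)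
  refine hS.mono fun (y : g.Site) (y' : g.Site) => ?_
  set AV : ℝ := θ₀ * g.M⁻¹ with hAVdef
  have hL1 : 1 ≤ g.L := hF.one_le_L
  have hL₀ : g.L ≤ L₀ := hF.L_le
  have hL₀0 : 0 ≤ L₀ := le_trans (zero_le_one.trans hL1) hL₀
  have htr : Real.exp (-(α * δ * g.dist y y')) * g.len y' ^ (-1 : ℝ) ≤ g.L ^ |(-1 : ℝ)| * g.len y ^ (-1 : ℝ) :=
    scaleTransfer_len_rpow hF (-1) (by rw [abs_neg, abs_one]; norm_num) y y'
  rw [abs_neg, abs_one, Real.rpow_one, Real.rpow_neg_one, Real.rpow_neg_one] at htr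
  have hratio : g.len y * (g.len y')⁻¹ * Real.exp (-(α * δ * g.dist y y')) ≤ g.L := by
    have hy : g.len y ≠ 0 := (hlen y).ne'
    have h1 : g.len y * (Real.exp (-(α * δ * g.dist y y')) * (g.len y')⁻¹) ≤ g.len y * (g.L * (g.len y)⁻¹) :=
      mul_le_mul_of_nonneg_left htr (hlen y).le
    have h2 : g.len y * (g.L * (g.len y)⁻¹) = g.L := by field_simp
    calc g.len y * (g.len y')⁻¹ * Real.exp (-(α * δ * g.dist y y')) = g.len y * (Real.exp (-(α * δ * g.dist y y')) * (g.len y')⁻¹) := by ring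
      _ ≤ g.L := by rw [← h2]; exact h1
  have hdsym : g.dist y' y = g.dist y y' := hs.symm y' y
  have htarget0 : 0 ≤ NF * AV * Real.sqrt L₀ * Real.exp (-((δ₀ - α * δ) * g.dist y y')) := by positivity
  have hexp1 : Real.exp (-(α * δ * g.dist y y')) ≤ 1 := by
    rw [Real.exp_le_one_iff]
    have := hs.dnn y y'
    nlinarith
  have hkey : g.len y * (g.len y')⁻¹ * Real.exp (-(α * δ * g.dist y y')) ^ 2 ≤ L₀ := by
    calc g.len y * (g.len y')⁻¹ * Real.exp (-(α * δ * g.dist y y')) ^ 2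
        = (g.len y * (g.len y')⁻¹ * Real.exp (-(α * δ * g.dist y y'))) * Real.exp (-(α * δ * g.dist y y')) := by ring
      _ ≤ g.L * 1 := mul_le_mul hratio hexp1 (Real.exp_nonneg _) (zero_le_one.trans hL1)
      _ ≤ L₀ := by rw [mul_one]; exact hL₀
  have hE : Real.exp (-(δ₀ * g.dist y y')) = Real.exp (-(α * δ * g.dist y y')) * Real.exp (-((δ₀ - α * δ) * g.dist y y')) := by
    rw [← Real.exp_add]; congr 1; ring
  have hprod : (NF * AV * g.len y * (g.len y')⁻¹ * Real.exp (-(δ₀ * g.dist y y'))) * (NF * AV * Real.exp (-(δ₀ * g.dist y' y)))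
      ≤ (NF * AV * Real.sqrt L₀ * Real.exp (-((δ₀ - α * δ) * g.dist y y'))) ^ 2 := by
    have hsq : (NF * AV * Real.sqrt L₀ * Real.exp (-((δ₀ - α * δ) * g.dist y y'))) ^ 2
        = NF ^ 2 * AV ^ 2 * L₀ * Real.exp (-((δ₀ - α * δ) * g.dist y y')) ^ 2 := by
      rw [mul_pow, mul_pow, mul_pow, Real.sq_sqrt hL₀0]
    rw [hdsym, hsq, hE]
    have hnn : 0 ≤ NF ^ 2 * AV ^ 2 * Real.exp (-((δ₀ - α * δ) * g.dist y y')) ^ 2 := by positivity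
    calc NF * AV * g.len y * (g.len y')⁻¹ * (Real.exp (-(α * δ * g.dist y y')) * Real.exp (-((δ₀ - α * δ) * g.dist y y')))
          * (NF * AV * (Real.exp (-(α * δ * g.dist y y')) * Real.exp (-((δ₀ - α * δ) * g.dist y y'))))
        = (g.len y * (g.len y')⁻¹ * Real.exp (-(α * δ * g.dist y y')) ^ 2) * (NF ^ 2 * AV ^ 2 * Real.exp (-((δ₀ - α * δ) * g.dist y y')) ^ 2) := by ring
      _ ≤ L₀ * (NF ^ 2 * AV ^ 2 * Real.exp (-((δ₀ - α * δ) * g.dist y y')) ^ 2) := mul_le_mul_of_nonneg_right hkey hnn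
      _ = NF ^ 2 * AV ^ 2 * L₀ * Real.exp (-((δ₀ - α * δ) * g.dist y y')) ^ 2 := by ring
  calc Real.sqrt ((NF * AV * g.len y * (g.len y')⁻¹ * Real.exp (-(δ₀ * (toB6 g R H).dist y y'))) * (NF * AV * Real.exp (-(δ₀ * (toB6 g R H).dist y' y))))
      ≤ Real.sqrt ((NF * AV * Real.sqrt L₀ * Real.exp (-((δ₀ - α * δ) * g.dist y y'))) ^ 2) := by
        simp only [toB6_dist]; exact Real.sqrt_le_sqrt hprod
    _ = NF * AV * Real.sqrt L₀ * Real.exp (-((δ₀ - α * δ) * g.dist y y')) := Real.sqrt_sq htarget0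

/-! ## §3 The drop-in forms: `Factors389` in, the sixth member and the two families out -/

/-- ★★★ **THE SIXTH `L²` MEMBER OF (3.46) FOR `G(U)` FROM THE HEAD LEGS AND `Factors389` ALONE — NO THIRD-ORDER SCHEMA, NO SUP MAJORANT OF `G`**: §1 fed by §2 (rate
`δ₁ ≤ δ₀ − αδ`; smallness `N_F·θ₀M⁻¹·√L₀·c₁(α₁) ≤ ½`, print's «M sufficiently large»).
[cite: Balaban1985BackgroundPropagators, Thm 3.10 (3.105)–(3.108) pp.414–416, p.413, (3.46) p.398, p.391; Balaban1984PropagatorsII, (2.52)–(2.55) pp.232–233, Lemma 2.1 (2.60)–(2.61) p.234] -/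
theorem l2line5_left_of_factors389 [Fintype X] [DecidableEq X] [Fintype ι] [Fintype A]
    (𝔬 : Ops310 g B X Y ι A) (𝔡 : DirOps310 𝔬 P) (R : ℝ) (H : Prop) (d d₁ : ℕ) (δ α L₀ δ₁ α₁ ρ N N' NF Cℓ N3 B3 θ₀ δ₀ : ℝ) (κ : Sizes310)
    (S3 : ι → Finset g.Site) (U : B.Cfg)
    (hNF : 0 ≤ NF) (hN3 : 0 ≤ N3) (hB3 : 0 ≤ B3) (hθ₀ : 0 ≤ θ₀) (hM : 1 ≤ g.M) (hαδ : 0 ≤ α * δ)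
    (hα₁δ₁ : 0 ≤ α₁ * δ₁) (hα₁δ₁' : α₁ * δ₁ ≤ δ₁) (hδ₁ : δ₁ ≤ δ₀ - α * δ)
    (hs : StaticOK310 𝔬 ρ N N' NF Cℓ κ) (hcnt3 : ∀ a : g.Site, (∑ i, if a ∈ S3 i then (1 : ℝ) else 0) ≤ N3)
    (h261 : Ineq261 d₁ (toB6 g R H) δ₁ α₁) (hF : Facts347 g R H d δ α L₀) (hinvT : 𝔬.Δa U * 𝔬.G U = 1)
    (h105T : (∑ i, mulOp (𝔬.h i) * 𝔬.Gsq U i * mulOp (𝔬.h i)) * 𝔬.Δa U = 1 - ∑ a, 𝔬.Rt U a)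
    (hL : L2SecondLegs310 𝔬 𝔡 R H S3 B3 δ₁ U) (hfac : Factors389 𝔬 R H θ₀ δ₀ U) (hRT : ∀ a, IsTransposePair (𝔬.Rt U a) (𝔬.Rf U a))
    (hsmall : NF * (θ₀ * g.M⁻¹) * Real.sqrt L₀ * B6.c1 d₁ δ₁ α₁ ≤ 1 / 2) (ν μ : P) :
    BlockBd (g := toB6 g R H) 𝔬.blk 𝔬.blk (𝔬.G U ∘ₗ (𝔡.Dsd U ν ∘ₗ 𝔡.Dsd U μ))
      (fun (y y' : g.Site) => 2 * (N3 * B3) * Real.exp (-((1 - α₁) * δ₁ * g.dist y y'))) := by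
  have hV0 := blockBd_sumRt_of_factors389 (R := R) (H := H) 𝔬 U hF hαδ hθ₀ hNF hM hs hfac hRT
  have hθ : 0 ≤ NF * (θ₀ * g.M⁻¹) * Real.sqrt L₀ := mul_nonneg (mul_nonneg hNF (mul_nonneg hθ₀ (inv_nonneg.mpr (zero_le_one.trans hM)))) (Real.sqrt_nonneg _)
  have hV : BlockBd (g := toB6 g R H) 𝔬.blk 𝔬.blk (∑ a, 𝔬.Rt U a)
      (fun (y y' : g.Site) => NF * (θ₀ * g.M⁻¹) * Real.sqrt L₀ * Real.exp (-(δ₁ * g.dist y y'))) := by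
    refine hV0.mono fun a b => mul_le_mul_of_nonneg_left ?_ hθ
    exact Real.exp_le_exp.mpr (neg_le_neg (mul_le_mul_of_nonneg_right hδ₁ (hs.dnn a b)))
  exact l2line5_left_of_blockBd310 𝔬 𝔡 R H d₁ δ₁ α₁ ρ N N' NF Cℓ N3 B3 _ κ S3 U hN3 hB3 hθ hα₁δ₁ hα₁δ₁' hs hcnt3 h261 hinvT h105T hL hV hsmall ν μ

variable [Fintype P]

/-- ★★★ **THE PACKAGED FAMILY `G∇\*_{U,ν}∇\*_{U,μ}` OVER `P × P` FROM THE HEAD LEGS AND `Factors389` ALONE** (the drop-in for `blockBd_second_family5`): `|P|·2N₃B₃·e^{−(1−α₁)δ₁d}`.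
[cite: Balaban1985BackgroundPropagators, (3.46) p.398 + (3.39) p.397 + Thm 3.10 pp.414–416] -/
theorem blockBd_second_family5_left_of_factors389 [Fintype X] [DecidableEq X] [Fintype ι] [Fintype A]
    (𝔬 : Ops310 g B X Y ι A) (𝔡 : DirOps310 𝔬 P) (R : ℝ) (H : Prop) (d d₁ : ℕ) (δ α L₀ δ₁ α₁ ρ N N' NF Cℓ N3 B3 θ₀ δ₀ : ℝ) (κ : Sizes310)
    (S3 : ι → Finset g.Site) (U : B.Cfg)
    (hNF : 0 ≤ NF) (hN3 : 0 ≤ N3) (hB3 : 0 ≤ B3) (hθ₀ : 0 ≤ θ₀) (hM : 1 ≤ g.M) (hαδ : 0 ≤ α * δ)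
    (hα₁δ₁ : 0 ≤ α₁ * δ₁) (hα₁δ₁' : α₁ * δ₁ ≤ δ₁) (hδ₁ : δ₁ ≤ δ₀ - α * δ)
    (hs : StaticOK310 𝔬 ρ N N' NF Cℓ κ) (hcnt3 : ∀ a : g.Site, (∑ i, if a ∈ S3 i then (1 : ℝ) else 0) ≤ N3)
    (h261 : Ineq261 d₁ (toB6 g R H) δ₁ α₁) (hF : Facts347 g R H d δ α L₀) (hinvT : 𝔬.Δa U * 𝔬.G U = 1)
    (h105T : (∑ i, mulOp (𝔬.h i) * 𝔬.Gsq U i * mulOp (𝔬.h i)) * 𝔬.Δa U = 1 - ∑ a, 𝔬.Rt U a)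
    (hL : L2SecondLegs310 𝔬 𝔡 R H S3 B3 δ₁ U) (hfac : Factors389 𝔬 R H θ₀ δ₀ U) (hRT : ∀ a, IsTransposePair (𝔬.Rt U a) (𝔬.Rf U a))
    (hsmall : NF * (θ₀ * g.M⁻¹) * Real.sqrt L₀ * B6.c1 d₁ δ₁ α₁ ≤ 1 / 2) :
    BlockBd (g := toB6 g R H) 𝔬.blk (𝔬.blk ∘ Prod.fst)
      (familyOp fun p : P × P => 𝔬.G U ∘ₗ (𝔡.Dsd U p.1 ∘ₗ 𝔡.Dsd U p.2))
      (fun (a b : g.Site) => (Fintype.card P : ℝ) * (2 * (N3 * B3)) * Real.exp (-((1 - α₁) * δ₁ * g.dist a b))) := by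
  have hK : 0 ≤ 2 * (N3 * B3) := by positivity
  have h := blockBd_familyOp (R := R) (H := H) 𝔬.blk 𝔬.blk (P := P × P)
    (T := fun p : P × P => 𝔬.G U ∘ₗ (𝔡.Dsd U p.1 ∘ₗ 𝔡.Dsd U p.2))
    (fun a b => mul_nonneg hK (Real.exp_nonneg _))
    (fun p => l2line5_left_of_factors389 𝔬 𝔡 R H d d₁ δ α L₀ δ₁ α₁ ρ N N' NF Cℓ N3 B3 θ₀ δ₀ κ S3 U hNF hN3 hB3 hθ₀ hM hαδ hα₁δ₁ hα₁δ₁' hδ₁ hs hcnt3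
      h261 hF hinvT h105T hL hfac hRT hsmall p.1 p.2)
  refine h.mono fun a b => le_of_eq ?_
  rw [Fintype.card_prod, Nat.cast_mul, Real.sqrt_mul_self (Nat.cast_nonneg _)]
  ring

/-- ★★★ **THE PACKAGED FAMILY `∇_{U,ν}∇_{U,μ}G` OVER `P × P` FROM THE HEAD LEGS AND `Factors389` ALONE** (the drop-in for `blockBd_second_family3`; `G` symmetric, Thm 3.11).
[cite: Balaban1985BackgroundPropagators, (3.46) p.398 + (3.39) p.397 + Thm 3.10 pp.414–416 + p.391] -/
theorem blockBd_second_family3_left_of_factors389 [Fintype X] [DecidableEq X] [Fintype ι] [Fintype A]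
    (𝔬 : Ops310 g B X Y ι A) (𝔡 : DirOps310 𝔬 P) (R : ℝ) (H : Prop) (d d₁ : ℕ) (δ α L₀ δ₁ α₁ ρ N N' NF Cℓ N3 B3 θ₀ δ₀ : ℝ) (κ : Sizes310)
    (S3 : ι → Finset g.Site) (U : B.Cfg)
    (hNF : 0 ≤ NF) (hN3 : 0 ≤ N3) (hB3 : 0 ≤ B3) (hθ₀ : 0 ≤ θ₀) (hM : 1 ≤ g.M) (hαδ : 0 ≤ α * δ)
    (hα₁δ₁ : 0 ≤ α₁ * δ₁) (hα₁δ₁' : α₁ * δ₁ ≤ δ₁) (hδ₁ : δ₁ ≤ δ₀ - α * δ)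
    (hs : StaticOK310 𝔬 ρ N N' NF Cℓ κ) (hcnt3 : ∀ a : g.Site, (∑ i, if a ∈ S3 i then (1 : ℝ) else 0) ≤ N3)
    (h261 : Ineq261 d₁ (toB6 g R H) δ₁ α₁) (hF : Facts347 g R H d δ α L₀) (hinvT : 𝔬.Δa U * 𝔬.G U = 1)
    (h105T : (∑ i, mulOp (𝔬.h i) * 𝔬.Gsq U i * mulOp (𝔬.h i)) * 𝔬.Δa U = 1 - ∑ a, 𝔬.Rt U a)
    (hL : L2SecondLegs310 𝔬 𝔡 R H S3 B3 δ₁ U) (hfac : Factors389 𝔬 R H θ₀ δ₀ U) (hRT : ∀ a, IsTransposePair (𝔬.Rt U a) (𝔬.Rf U a))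
    (hDT : DirTranspose310 𝔬 𝔡 U) (hsym : IsTransposePair (𝔬.G U) (𝔬.G U))
    (hsmall : NF * (θ₀ * g.M⁻¹) * Real.sqrt L₀ * B6.c1 d₁ δ₁ α₁ ≤ 1 / 2) :
    BlockBd (g := toB6 g R H) 𝔬.blk (𝔬.blk ∘ Prod.fst)
      (familyOp fun p : P × P => (𝔡.Dd U p.1 ∘ₗ 𝔡.Dd U p.2) ∘ₗ 𝔬.G U)
      (fun (a b : g.Site) => (Fintype.card P : ℝ) * (2 * (N3 * B3)) * Real.exp (-((1 - α₁) * δ₁ * g.dist a b))) := by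
  have hK : 0 ≤ 2 * (N3 * B3) := by positivity
  have hV0 := blockBd_sumRt_of_factors389 (R := R) (H := H) 𝔬 U hF hαδ hθ₀ hNF hM hs hfac hRT
  have hθ : 0 ≤ NF * (θ₀ * g.M⁻¹) * Real.sqrt L₀ := mul_nonneg (mul_nonneg hNF (mul_nonneg hθ₀ (inv_nonneg.mpr (zero_le_one.trans hM)))) (Real.sqrt_nonneg _)
  have hV : BlockBd (g := toB6 g R H) 𝔬.blk 𝔬.blk (∑ a, 𝔬.Rt U a)
      (fun (y y' : g.Site) => NF * (θ₀ * g.M⁻¹) * Real.sqrt L₀ * Real.exp (-(δ₁ * g.dist y y'))) := by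
    refine hV0.mono fun a b => mul_le_mul_of_nonneg_left ?_ hθ
    exact Real.exp_le_exp.mpr (neg_le_neg (mul_le_mul_of_nonneg_right hδ₁ (hs.dnn a b)))
  have h := blockBd_familyOp (R := R) (H := H) 𝔬.blk 𝔬.blk (P := P × P)
    (T := fun p : P × P => (𝔡.Dd U p.1 ∘ₗ 𝔡.Dd U p.2) ∘ₗ 𝔬.G U)
    (fun a b => mul_nonneg hK (Real.exp_nonneg _))
    (fun p => l2line3_left_of_blockBd310 𝔬 𝔡 R H d₁ δ₁ α₁ ρ N N' NF Cℓ N3 B3 _ κ S3 U hN3 hB3 hθ hα₁δ₁ hα₁δ₁' hs hcnt3 h261 hinvT h105T hL hV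
      hsmall hDT hsym p.1 p.2)
  refine h.mono fun a b => le_of_eq ?_
  rw [Fintype.card_prod, Nat.cast_mul, Real.sqrt_mul_self (Nat.cast_nonneg _)]
  ring

end GSide

end

end Literature.MathematicalPhysics.QuantumFieldTheory.Balaban1983to89.B9RWSums346SecondDiffLeft
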